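import Summits.BirchSwinnertonDyer.BirchSwinnertonDyer.Theorems.ByReductionTypeAtTwoSupersingularThetaHabitatStubsBothSides
import Summits.BirchSwinnertonDyer.BirchSwinnertonDyer.Theorems.ThetaPartnerAtTwoSignedMainConjectureCMTwoMuBound
import Summits.BirchSwinnertonDyer.BirchSwinnertonDyer.Theorems.ByReductionTypeAtTwoSupersingularHalvesTwo
import HarnessLib

/-!
# Crux `SupersingularRankZeroAtTwo` (item stmt-BirchSwinnertonDyer-19097, route `ByReductionTypeAtTwo`, rung K4):
# the UNIT-ANCHOR TRANSPORT road at `p = 2`, `a₂ = 0` — the Kato half and BSD₂ of `W` from a congruent curve `A`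
# (`W[2] ≅ A[2]`, CM OR NOT) lying in the DOUBLE UNIT ZONE, with NO Eisenstein-side input, NO CM theory and NO
# analytic transport (seat `bsd-2adic-ss-1x` GEN 4, WIDTH-LEVER second prover lane; congruence-transport road)

HONEST FRAMING (cells `bsd-2adic` run/shared/lean/pub/bsd-2adic/ and `bsd-wall` …/bsd-wall/; HUMAN RULINGS
D-0036/D-0054/D-0074): THEOREMS ONLY — no definition, no named fact, no instance, no `sorry`; every research input is
an explicit hypothesis spelled inline; nothing about any Selmer group or `L`-value is asserted beyond the displayed
binders; closes no item; BSD is NOT proved by any of this. PARTITION (D-0054): X5@2 good-supersingular `a₂ = 0`, the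
UNIT-ANCHOR sub-row (census UNIT-ANCHOR-v1, kit j287435: 17/208 rank-`0` classes with a same-`a₂` unit-zone packet-mate
in Cremona's range, 3 of them on the theta habitat) × `p = 2` — types-the-object-of.

THE ROAD. GEN 0–3 of this lane closed the theta habitat (19 classes) modulo the research legs {K1 (signed transport from
a CM partner `A`: tp2-p1's stubs), (2′) at `E` and at `A`, (4)ʳᵃᵗ at `E` and at `A`, `μ⁺(A) = 0`}; the ONE leg nobody
owns is `μ⁺(A) = 0` at the CM partner (Pollack–Rubin at the inert prime `2`: open). Here the CM partner is replaced by
ANY curve `A` with `A[2] ≅ W[2]`, good supersingular at `2` with `a₂(A) = 0`, `L(A,1) ≠ 0`, lying in the DOUBLE UNIT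
ZONE `2 ∤ ∏c_ℓ(A)`, `2 ∤ #Ш(A)`. There (`charIdeal_eq_top_and_mu_eq_zero_of_odd_tamagawa_of_odd_sha_two`, tp2-p2, from
Kim's control term ALONE) `char X⁺(A/ℚ_∞) = Λ` and `μ⁺(A) = 0` — NO main conjecture, NO elliptic units, NO
Burungale–Flach. B. D. Kim's residual `μ`-transport along `W[2] ≅ A[2]` (Cor. 2.13 `μ`-half READ AT `2`: the binder
`hmu2` of tp2-p1's bridge `SignedTransportAtTwo.kobayashiMainConjecture_two_of_signedTransportBinders`, p512985,
instantiated AT THE PAIR — CM-free) gives `μ⁺(W) = 0`; then Kato's divisibility up to `2^m` at `W` (19097's (1′)+(4)ʳᵃᵗ,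
`ThetaPartnerXRoute.katoUpTo_at_of_colemanKatoRat_at`) is an EXACT divisibility (§1: `2 ∤ g ⇒ 2^m ∣ h`,
`ThetaPartnerXRoute.exists_mul_eq_of_mul_eq_C_pow_mul_of_not_C_dvd`, `ϖ` odd by Abbes–Ullmo `h2`), whence the Kato half
`MissingUpperBoundAt W 2` (`missingUpperBoundAt_two_of_signedUpperDivisibility_two`, lane A) and, with the class's
descent certificate `MissingLowerBoundAt W 2`, `BSDp W 2`.
RESEARCH CONTENT per class (numbers, not adjectives): {`μ`-transport at `2` along `W[2] ≅ A[2]` (ONE binder, the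
algebraic `μ`-half of K1, CM-free), (2′) at `W` and at `A`, (4)ʳᵃᵗ at `W`} + PUB {hmod, hGZK, Kato 12.4 (1′), h2} + CERT
{`2 ∤ ∏c_ℓ(A)`, `2 ∤ #Ш(A)` (2-descent on the anchor), `W[2] ≅ A[2]` (kernel, Tschirnhaus), hsha}. ABSENT compared with
the theta-habitat doors (p549774/p552398): the CM partner, `μ⁺(A) = 0` as a research clause, Burungale–Flach, (4)ʳᵃᵗ at
`A`, the analytic transport V2 / K1's `λ`-half, `L(A,1) ≠ 0` certificates (here `L(A,1) ≠ 0` is `r_an(A) = 0`, decided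
by Cremona's tables for the anchor). CENSUS (kit j287435 + ENGINE-2 j248632): on all 62 X5 classes with such an anchor
(17 with `a₂ = 0`), the unit-anchor prediction `λ♭(W) = Σ_{S₀}(δ(A) − δ(W))` (Kim's `λ`-transport from `λ♭(A) = 0`)
EQUALS the certified analytic `λ♭(W)`, 62/62 — the numerical shadow of this road.

References: [BDKim2009] B. D. Kim, "The plus/minus Selmer groups for supersingular primes and congruences", Cor. 2.13,
Prop. 2.6; [GreenbergVatsal2000] Thm. (1.4) and p. 2 (1)–(2); [Kobayashi2003] Thm. 1.2, Thm. 4.1 (p. 8), Conjecture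
(p. 2); [Kato2004Asterisque] Thm. 12.4–12.5 (3); [BDKim2013] Cor. 3.15; [AbbesUllmo1996] Thm. A; [Washington1997] §7.1,
§13.2; [Miller2011LMS] Def. 1.1; census run/shared/lean/pub/bsd-2adic/ss1x/gen4/UNIT-ANCHOR-CENSUS-v1.md.
-/

set_option autoImplicit false
-- the Theorems namespace of this sub repeats the summit name by design (D-0017 nested layout)
set_option linter.dupNamespace false

noncomputable section

open scoped Classical MatrixGroups ModularForm

open CongruenceSubgroup WeierstrassCurve Literature.NumberTheory.EllipticCurves
  Literature.NumberTheory.EllipticCurves.ModularForms Literature.NumberTheory.EllipticCurves.Sprung2017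
  Literature.NumberTheory.EllipticCurves.Rank1Residual Literature.NumberTheory.EllipticCurves.Rank1Residual.Typed
  Literature.NumberTheory.EllipticCurves.Kobayashi2003 Literature.NumberTheory.EllipticCurves.IwasawaDual
  ZpExtension Summit.BirchSwinnertonDyer.Rank1Residual Summit.BirchSwinnertonDyer.Rank1Residual.Supersingular
  Summit.BirchSwinnertonDyer.Rank1Residual.X5.O1

namespace Summit.BirchSwinnertonDyer.BirchSwinnertonDyer.Theorems

namespace SSUnitAnchor

/-! ## §1 At ONE curve: the EXACT Kato half from the `2^m`-Kato half and `μ⁺ = 0`; the Miller upper half -/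

section OneCurve

variable (W : WeierstrassCurve ℚ) [W.IsElliptic] [W.IsGloballyMinimal]

/-- **`μ⁺(W) = 0` turns Kato's divisibility UP TO `2^m` into the exact Kato half.** At a curve `W` good supersingular
at `2`: if every signed dual datum is `Λ`-torsion with `μ = 0` (`hmu`), then a divisibility `char X⁺ = (g)`,
`ι(g·h) = 2^m·ϖ·ι L♭` (`hup`, the output shape of `ThetaPartnerXRoute.katoUpTo_at_of_colemanKatoRat_at`) is an exact one
`ι(g·h′) = ϖ·ι L♭`: `μ = 0 ⇒ 2 ∤ g` (`muInvariant_eq_zero_iff_not_C_dvd_of_charIdeal_eq_span`), `2` is prime in `Λ`, and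
`ϖ` is a `2`-adic unit (Abbes–Ullmo at `2`, `h2`). Pure bookkeeping; nothing asserted beyond the binders.
[cite: GreenbergVatsal2000, p. 2, (1)–(2)] [cite: Washington1997, §7.1 and §13.2] [cite: AbbesUllmo1996, Thm. A] -/
theorem signedUpperDivisibility_two_of_katoUpTo_of_mu_eq_zero (h2 : realPeriodRat_eq_unit_mul_plusPeriod_two)
    (hss : GoodSS W 2)
    (hup : ∀ (κ : ZpExtension ℚ 2) (γ : Field.absoluteGaloisGroup ℚ),
        κ.IsCyclotomic → κ.IsTopGenerator γ → IsCyclotomicVariable 2 γ →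
      ∀ [NeZero (W.conductorNorm ℤ)] (f : CuspForm (Gamma0 (W.conductorNorm ℤ)) 2),
        IsNewformOf W f → ∀ (ϖ : ℚ), (ϖ : ℝ) * W.realPeriodRat = plusPeriod f →
      ∀ (Lplus Lminus : IwasawaAlgebra 2), IsPollackPair f 2 Lplus Lminus →
      ∀ (D : SignedSelmerDualData W κ γ 1),
        ∃ (g h : IwasawaAlgebra 2) (m : ℕ), D.charIdeal = Ideal.span {g} ∧
          iwasawaToPowerSeries 2 (g * h) =
            PowerSeries.C ((2 : ℚ_[2]) ^ m * (ϖ : ℚ_[2])) * iwasawaToPowerSeries 2 (kobayashiL 1 Lplus Lminus))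
    (hmu : ∀ (κ : ZpExtension ℚ 2) (γ : Field.absoluteGaloisGroup ℚ), κ.IsCyclotomic → κ.IsTopGenerator γ →
      ∀ D : SignedSelmerDualData W κ γ 1, Module.IsTorsion (IwasawaAlgebra 2) D.X ∧ D.mu = 0) :
    ∀ (κ : ZpExtension ℚ 2) (γ : Field.absoluteGaloisGroup ℚ),
      κ.IsCyclotomic → κ.IsTopGenerator γ → IsCyclotomicVariable 2 γ →
      ∀ [NeZero (W.conductorNorm ℤ)] (f : CuspForm (Gamma0 (W.conductorNorm ℤ)) 2),
        IsNewformOf W f → ∀ (ϖ : ℚ), (ϖ : ℝ) * W.realPeriodRat = plusPeriod f →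
      ∀ (Lplus Lminus : IwasawaAlgebra 2), IsPollackPair f 2 Lplus Lminus →
      ∀ (D : SignedSelmerDualData W κ γ 1),
        ∃ g h : IwasawaAlgebra 2, D.charIdeal = Ideal.span {g} ∧
          iwasawaToPowerSeries 2 (g * h) =
            PowerSeries.C (ϖ : ℚ_[2]) * iwasawaToPowerSeries 2 (kobayashiL 1 Lplus Lminus) := by
  intro κ γ hκ hγ hγ' _ f hf ϖ hϖ Lplus Lminus hPP D
  haveI : Module.Finite (IwasawaAlgebra 2) D.X := Kobayashi2003.SignedSelmerDualData.moduleFinite hγ D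
  obtain ⟨g, h, m, hchar, hgh⟩ := hup κ γ hκ hγ hγ' f hf ϖ hϖ Lplus Lminus hPP D
  obtain ⟨hTors, hμ⟩ := hmu κ γ hκ hγ D
  -- `μ⁺ = 0` ⟹ `2 ∤ g`
  have hg : ¬ PowerSeries.C ((2 : ℕ) : ℤ_[2]) ∣ g :=
    (muInvariant_eq_zero_iff_not_C_dvd_of_charIdeal_eq_span D.X hTors hchar).mp hμ
  have hgh' : iwasawaToPowerSeries 2 (g * h) =
      PowerSeries.C ((((2 : ℕ) : ℕ) : ℚ_[2]) ^ m * (ϖ : ℚ_[2])) *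
        iwasawaToPowerSeries 2 (kobayashiL 1 Lplus Lminus) := by
    rw [hgh]; norm_num
  obtain ⟨h', hh'⟩ := ThetaPartnerXRoute.exists_mul_eq_of_mul_eq_C_pow_mul_of_not_C_dvd
    (ThetaPartnerXRoute.norm_ratCast_le_one_of_padicValRat_eq_zero
      (padicValRat_periodRatio_eq_zero_two W h2 hss hf hϖ)) hgh' hg
  exact ⟨g, h', hchar, hh'⟩

/-- **The Miller UPPER half at `2` (`ord₂ #Ш ≤ ord₂ #Ш_an`) from `μ⁺(W) = 0`, the `2^m`-Kato half and control — the
`E`-side statement GEN 3 left as remark (iv).** For `W` good supersingular at `2` with `a₂ = 0` and `r_an = 0`: PUB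
{modularity `hmod`, GZK `hGZK`, Kato 12.4 PUB `h124`/`hX0`, the period fact `h2`}; (2′) at `W` (`hEC`, 19097's
`stub_zeroSignedEulerChar` body AT `W`); (4)ʳᵃᵗ at `W` (`hCK`, the rational Coleman–Kato package AT `W`); and ONE more
input: every signed dual datum of `W` has `μ = 0` (`hmu0`). Then `MissingUpperBoundAt W 2`. Chain: (2′) ⇒ torsion +
Kim's term (`ThetaPartnerXRoute.torsion_of_signedEulerChar_at` / `kimTerm_of_signedEulerChar_at`), (1′)+(4)ʳᵃᵗ ⇒ the
`2^m`-Kato half (`katoUpTo_at_of_colemanKatoRat_at`), `μ = 0` ⇒ exact (above), then lane A's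
`missingUpperBoundAt_two_of_signedUpperDivisibility_two`. [cite: Kobayashi2003, Thm. 1.2 and Thm. 4.1 (p. 8)]
[cite: Kato2004Asterisque, Thm. 12.4–12.5 (3)] [cite: BDKim2013, Cor. 3.15] [cite: Miller2011LMS, Def. 1.1] -/
theorem missingUpperBoundAt_two_of_mu_eq_zero_of_katoUpTo (hmod : nonempty_modularParametrizationData)
    (hGZK : rank_eq_analyticRank_of_analyticRank_le_one)
    (h124 : Kato2004.thm12_4) (hX0 : Kato2004_fineSelmerDual_isTorsion) (h2 : realPeriodRat_eq_unit_mul_plusPeriod_two)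
    (hr : W.analyticRank = 0) (hss : GoodSS W 2) (ha : W.frobeniusTrace 2 = 0)
    (hEC : ∀ (κ : ZpExtension ℚ 2) (γ : Field.absoluteGaloisGroup ℚ),
          κ.IsCyclotomic → κ.IsTopGenerator γ → Finite (W.selmerGroupPInfty 2) →
          Finite (endInvariants (conjSignedSelmerInfty W κ 1 γ - 1)) ∧
            ∃ u : ℤ_[2]ˣ, (Nat.card (endInvariants (conjSignedSelmerInfty W κ 1 γ - 1)) : ℚ_[2]) =
              ((u : ℤ_[2]) : ℚ_[2]) * ((2 : ℕ) : ℚ_[2]) ^ (padicValNat 2 W.tamagawaProduct) *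
                (Nat.card (W.selmerGroupPInfty 2) : ℚ_[2]) *
                  (Nat.card (EndCoinvariants (conjSignedSelmerInfty W κ 1 γ - 1)) : ℚ_[2]))
    (hCK : ∀ (κ : ZpExtension ℚ 2) (γ : Field.absoluteGaloisGroup ℚ),
        κ.IsCyclotomic → κ.IsTopGenerator γ → IsCyclotomicVariable 2 γ →
        ∀ [NeZero (W.conductorNorm ℤ)] (f : CuspForm (Gamma0 (W.conductorNorm ℤ)) 2),
          IsNewformOf W f → ∀ (ϖ : ℚ), (ϖ : ℝ) * W.realPeriodRat = plusPeriod f →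
        ∀ (Lplus Lminus : IwasawaAlgebra 2), IsPollackPair f 2 Lplus Lminus →
        ∀ (D : SignedSelmerDualData W κ γ 1) [ContinuousSMul ℤ_[2] (W.tateModule 2)],
          ∃ (I : Kato2004.IwasawaH1Data W 2 κ γ) (Y : W.FineSelmerDualData κ γ)
            (P : Submodule (IwasawaAlgebra 2) (IwasawaAlgebra 2))
            (loc : I.H →ₗ[IwasawaAlgebra 2] P) (toX : P →ₗ[IwasawaAlgebra 2] D.X)
            (δ : D.X →ₗ[IwasawaAlgebra 2] Y.X) (Z : Submodule (IwasawaAlgebra 2) I.H)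
            (G : IwasawaAlgebra 2),
            Function.Exact loc toX ∧ Function.Exact toX δ ∧
            G ∈ Submodule.map (P.subtype ∘ₗ loc) Z ∧
            iwasawaToPowerSeries 2 G =
              PowerSeries.C (ϖ : ℚ_[2]) * iwasawaToPowerSeries 2 (kobayashiL 1 Lplus Lminus) ∧
            (∀ 𝔭 : PrimeSpectrum (IwasawaAlgebra 2), 𝔭.asIdeal.height = 1 →
              PowerSeries.C (2 : ℤ_[2]) ∉ 𝔭.asIdeal →
              Literature.NumberTheory.EllipticCurves.Module.lengthAt (IwasawaAlgebra 2) Y.X 𝔭 ≤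
                Literature.NumberTheory.EllipticCurves.Module.lengthAt (IwasawaAlgebra 2) (I.H ⧸ Z) 𝔭))
    (hmu0 : ∀ (κ : ZpExtension ℚ 2) (γ : Field.absoluteGaloisGroup ℚ), κ.IsCyclotomic → κ.IsTopGenerator γ →
      ∀ D : SignedSelmerDualData W κ γ 1, D.mu = 0) :
    MissingUpperBoundAt W 2 := by
  have hLrat : hasEntireLFunction_rat := WeierstrassCurve.hasEntireLFunction_rat_of_exists_isNewformOf
    (exists_isNewformOf_of_nonempty_modularParametrizationData hmod)
  have hL : W.entireLFunction 1 ≠ 0 := (W.analyticRank_eq_zero_iff_holds (hLrat W)).mp hr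
  have hTors := ThetaPartnerXRoute.torsion_of_signedEulerChar_at W hGZK hr hEC
  have h12 : ∀ (κ : ZpExtension ℚ 2) (γ : Field.absoluteGaloisGroup ℚ), κ.IsCyclotomic → κ.IsTopGenerator γ →
      ∀ D : SignedSelmerDualData W κ γ 1,
        Module.Finite (IwasawaAlgebra 2) D.X ∧ Module.IsTorsion (IwasawaAlgebra 2) D.X :=
    fun κ γ hκ hγ D => ⟨Kobayashi2003.SignedSelmerDualData.moduleFinite hγ D, hTors κ γ hκ hγ D⟩
  exact missingUpperBoundAt_two_of_signedUpperDivisibility_two W hmod hGZK hss.1 ha hL h12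
    (ThetaPartnerXRoute.kimTerm_of_signedEulerChar_at W hEC)
    (signedUpperDivisibility_two_of_katoUpTo_of_mu_eq_zero W h2 hss
      (ThetaPartnerXRoute.katoUpTo_at_of_colemanKatoRat_at h124 hX0 W hCK)
      (fun κ γ hκ hγ D => ⟨hTors κ γ hκ hγ D, hmu0 κ γ hκ hγ D⟩))

end OneCurve

/-! ## §2 At the ANCHOR: the double unit zone ⇒ `char X⁺(A/ℚ_∞) = Λ`, torsion and `μ⁺(A) = 0`, from control alone -/

section Anchor

variable (A : WeierstrassCurve ℚ) [A.IsElliptic] [A.IsGloballyMinimal]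

omit [A.IsGloballyMinimal] in
/-- **The UNIT-ZONE anchor needs no main conjecture.** For `A` with `r_an(A) = 0` (PUB: modularity, GZK), (2′) AT
`A` (`hECA`: 19097's `stub_zeroSignedEulerChar` body read at `A`), `2 ∤ ∏c_ℓ(A)` and `2 ∤ #Ш(A)`: every signed dual
datum of `A` at `2` is f.g. `Λ`-torsion with `char = Λ` and `μ = 0` — torsion by Greenberg's Thm. 1.4 mechanism
(`ThetaPartnerXRoute.torsion_of_signedEulerChar_at`), then tp2-p2's
`charIdeal_eq_top_and_mu_eq_zero_of_odd_tamagawa_of_odd_sha_two` with Kim's term from (2′)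
(`ThetaPartnerXRoute.kimTerm_of_signedEulerChar_at`). No `L`-value, period, CM structure or BSD₂(A) enters.
[cite: BDKim2013, Cor. 3.15 (p. 199; p odd in print)] [cite: GreenbergVatsal2000, p. 2, (1)–(2)]
[cite: GreenbergLNM1716, Thm. 1.4 (p. 61)] [cite: Washington1997, §13.2] -/
theorem torsion_and_charIdeal_eq_top_and_mu_eq_zero_of_unitZone (hmod : nonempty_modularParametrizationData)
    (hGZK : rank_eq_analyticRank_of_analyticRank_le_one) (hAr : A.analyticRank = 0)
    (hECA : ∀ (κ : ZpExtension ℚ 2) (γ : Field.absoluteGaloisGroup ℚ),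
          κ.IsCyclotomic → κ.IsTopGenerator γ → Finite (A.selmerGroupPInfty 2) →
          Finite (endInvariants (conjSignedSelmerInfty A κ 1 γ - 1)) ∧
            ∃ u : ℤ_[2]ˣ, (Nat.card (endInvariants (conjSignedSelmerInfty A κ 1 γ - 1)) : ℚ_[2]) =
              ((u : ℤ_[2]) : ℚ_[2]) * ((2 : ℕ) : ℚ_[2]) ^ (padicValNat 2 A.tamagawaProduct) *
                (Nat.card (A.selmerGroupPInfty 2) : ℚ_[2]) *
                  (Nat.card (EndCoinvariants (conjSignedSelmerInfty A κ 1 γ - 1)) : ℚ_[2]))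
    (hTam : ¬ 2 ∣ A.tamagawaProduct) (hSha : ¬ 2 ∣ A.shaOrder) :
    ∀ (κ : ZpExtension ℚ 2) (γ : Field.absoluteGaloisGroup ℚ), κ.IsCyclotomic → κ.IsTopGenerator γ →
      ∀ D : SignedSelmerDualData A κ γ 1, Module.Finite (IwasawaAlgebra 2) D.X ∧
        Module.IsTorsion (IwasawaAlgebra 2) D.X ∧ D.charIdeal = ⊤ ∧ D.mu = 0 := by
  intro κ γ hκ hγ D
  have hLrat : hasEntireLFunction_rat := WeierstrassCurve.hasEntireLFunction_rat_of_exists_isNewformOf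
    (exists_isNewformOf_of_nonempty_modularParametrizationData hmod)
  have hLA : A.entireLFunction 1 ≠ 0 := (A.analyticRank_eq_zero_iff_holds (hLrat A)).mp hAr
  haveI : Module.Finite (IwasawaAlgebra 2) D.X := Kobayashi2003.SignedSelmerDualData.moduleFinite hγ D
  have hTors : Module.IsTorsion (IwasawaAlgebra 2) D.X :=
    ThetaPartnerXRoute.torsion_of_signedEulerChar_at A hGZK hAr hECA κ γ hκ hγ D
  exact ⟨inferInstance, hTors, charIdeal_eq_top_and_mu_eq_zero_of_odd_tamagawa_of_odd_sha_two A hGZK hLA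
    (ThetaPartnerXRoute.kimTerm_of_signedEulerChar_at A hECA) hTam hSha hκ hγ D hTors⟩

end Anchor

/-! ## §3 The pair `(W, A)`: BSD₂'s Kato half for `W` from a unit-zone anchor `A` along `W[2] ≅ A[2]` -/

section Pair

variable (W : WeierstrassCurve ℚ) [W.IsElliptic] [W.IsGloballyMinimal]
  (A : WeierstrassCurve ℚ) [A.IsElliptic] [A.IsGloballyMinimal]

/-- **UNIT-ANCHOR TRANSPORT, upper half.** `W` good supersingular at `2` with `a₂ = 0` and `r_an(W) = 0`; `A` good
supersingular at `2` with `a₂ = 0`, `r_an(A) = 0`, in the double unit zone (`2 ∤ ∏c_ℓ(A)`, `2 ∤ #Ш(A)`); a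
`G_ℚ`-equivariant `W[2] ≃ A[2]` (`e`, `he`). Binders: PUB {`hmod`, `hGZK`, Kato 12.4 `h124`/`hX0`, `h2`}; AT `W`:
(2′) `hEC`, (4)ʳᵃᵗ `hCK`; AT `A`: (2′) `hECA`; AT THE PAIR: `hmuT` = B. D. Kim 2009 Cor. 2.13 `μ`-half READ AT `2`
(direction anchor → curve: `X⁺(A)` torsion with `μ = 0` ⇒ `μ⁺(W) = 0` for torsion `X⁺(W)`; the binder `hmu2` of
p512985 at this pair — a research input, CM-free). Conclusion: `MissingUpperBoundAt W 2`. Chain: §2 at `A`, `hmuT`,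
§1 at `W`. No CM partner, no `μ⁺(A) = 0` clause, no Burungale–Flach, no analytic transport, no (4)ʳᵃᵗ at `A`.
[cite: BDKim2009, Cor. 2.13 and Prop. 2.6] [cite: GreenbergVatsal2000, Thm. (1.4)]
[cite: Kobayashi2003, Thm. 1.2 and Thm. 4.1 (p. 8)] [cite: Kato2004Asterisque, Thm. 12.4–12.5 (3)]
[cite: BDKim2013, Cor. 3.15] [cite: Miller2011LMS, Def. 1.1] -/
theorem missingUpperBoundAt_two_of_unitAnchor (hmod : nonempty_modularParametrizationData)
    (hGZK : rank_eq_analyticRank_of_analyticRank_le_one)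
    (h124 : Kato2004.thm12_4) (hX0 : Kato2004_fineSelmerDual_isTorsion) (h2 : realPeriodRat_eq_unit_mul_plusPeriod_two)
    (hr : W.analyticRank = 0) (hss : GoodSS W 2) (ha : W.frobeniusTrace 2 = 0)
    (hAr : A.analyticRank = 0) (hAss : GoodSS A 2) (hAa : A.frobeniusTrace 2 = 0)
    (hTam : ¬ 2 ∣ A.tamagawaProduct) (hSha : ¬ 2 ∣ A.shaOrder)
    (e : WeierstrassCurve.geomTorsion W (2 : ℤ) ≃+ WeierstrassCurve.geomTorsion A (2 : ℤ))
    (he : ∀ (σ : Field.absoluteGaloisGroup ℚ) (P : WeierstrassCurve.geomTorsion W (2 : ℤ)), e (σ • P) = σ • e P)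
    (hEC : ∀ (κ : ZpExtension ℚ 2) (γ : Field.absoluteGaloisGroup ℚ),
          κ.IsCyclotomic → κ.IsTopGenerator γ → Finite (W.selmerGroupPInfty 2) →
          Finite (endInvariants (conjSignedSelmerInfty W κ 1 γ - 1)) ∧
            ∃ u : ℤ_[2]ˣ, (Nat.card (endInvariants (conjSignedSelmerInfty W κ 1 γ - 1)) : ℚ_[2]) =
              ((u : ℤ_[2]) : ℚ_[2]) * ((2 : ℕ) : ℚ_[2]) ^ (padicValNat 2 W.tamagawaProduct) *
                (Nat.card (W.selmerGroupPInfty 2) : ℚ_[2]) *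
                  (Nat.card (EndCoinvariants (conjSignedSelmerInfty W κ 1 γ - 1)) : ℚ_[2]))
    (hCK : ∀ (κ : ZpExtension ℚ 2) (γ : Field.absoluteGaloisGroup ℚ),
        κ.IsCyclotomic → κ.IsTopGenerator γ → IsCyclotomicVariable 2 γ →
        ∀ [NeZero (W.conductorNorm ℤ)] (f : CuspForm (Gamma0 (W.conductorNorm ℤ)) 2),
          IsNewformOf W f → ∀ (ϖ : ℚ), (ϖ : ℝ) * W.realPeriodRat = plusPeriod f →
        ∀ (Lplus Lminus : IwasawaAlgebra 2), IsPollackPair f 2 Lplus Lminus →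
        ∀ (D : SignedSelmerDualData W κ γ 1) [ContinuousSMul ℤ_[2] (W.tateModule 2)],
          ∃ (I : Kato2004.IwasawaH1Data W 2 κ γ) (Y : W.FineSelmerDualData κ γ)
            (P : Submodule (IwasawaAlgebra 2) (IwasawaAlgebra 2))
            (loc : I.H →ₗ[IwasawaAlgebra 2] P) (toX : P →ₗ[IwasawaAlgebra 2] D.X)
            (δ : D.X →ₗ[IwasawaAlgebra 2] Y.X) (Z : Submodule (IwasawaAlgebra 2) I.H)
            (G : IwasawaAlgebra 2),
            Function.Exact loc toX ∧ Function.Exact toX δ ∧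
            G ∈ Submodule.map (P.subtype ∘ₗ loc) Z ∧
            iwasawaToPowerSeries 2 G =
              PowerSeries.C (ϖ : ℚ_[2]) * iwasawaToPowerSeries 2 (kobayashiL 1 Lplus Lminus) ∧
            (∀ 𝔭 : PrimeSpectrum (IwasawaAlgebra 2), 𝔭.asIdeal.height = 1 →
              PowerSeries.C (2 : ℤ_[2]) ∉ 𝔭.asIdeal →
              Literature.NumberTheory.EllipticCurves.Module.lengthAt (IwasawaAlgebra 2) Y.X 𝔭 ≤
                Literature.NumberTheory.EllipticCurves.Module.lengthAt (IwasawaAlgebra 2) (I.H ⧸ Z) 𝔭))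
    (hECA : ∀ (κ : ZpExtension ℚ 2) (γ : Field.absoluteGaloisGroup ℚ),
          κ.IsCyclotomic → κ.IsTopGenerator γ → Finite (A.selmerGroupPInfty 2) →
          Finite (endInvariants (conjSignedSelmerInfty A κ 1 γ - 1)) ∧
            ∃ u : ℤ_[2]ˣ, (Nat.card (endInvariants (conjSignedSelmerInfty A κ 1 γ - 1)) : ℚ_[2]) =
              ((u : ℤ_[2]) : ℚ_[2]) * ((2 : ℕ) : ℚ_[2]) ^ (padicValNat 2 A.tamagawaProduct) *
                (Nat.card (A.selmerGroupPInfty 2) : ℚ_[2]) *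
                  (Nat.card (EndCoinvariants (conjSignedSelmerInfty A κ 1 γ - 1)) : ℚ_[2]))
    (hmuT : GoodSS W 2 → W.frobeniusTrace 2 = 0 → GoodSS A 2 → A.frobeniusTrace 2 = 0 →
      (∃ e : WeierstrassCurve.geomTorsion W (2 : ℤ) ≃+ WeierstrassCurve.geomTorsion A (2 : ℤ),
        ∀ (σ : Field.absoluteGaloisGroup ℚ) (P : WeierstrassCurve.geomTorsion W (2 : ℤ)), e (σ • P) = σ • e P) →
      ∀ (κ : ZpExtension ℚ 2) (γ : Field.absoluteGaloisGroup ℚ), κ.IsCyclotomic → κ.IsTopGenerator γ →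
      ∀ (D : SignedSelmerDualData W κ γ 1) (D' : SignedSelmerDualData A κ γ 1)
        [Module.Finite (IwasawaAlgebra 2) D.X] [Module.Finite (IwasawaAlgebra 2) D'.X],
        Module.IsTorsion (IwasawaAlgebra 2) D.X → Module.IsTorsion (IwasawaAlgebra 2) D'.X →
        D'.mu = 0 → D.mu = 0) :
    MissingUpperBoundAt W 2 := by
  have hA := torsion_and_charIdeal_eq_top_and_mu_eq_zero_of_unitZone A hmod hGZK hAr hECA hTam hSha
  have hTorsW := ThetaPartnerXRoute.torsion_of_signedEulerChar_at W hGZK hr hEC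
  refine missingUpperBoundAt_two_of_mu_eq_zero_of_katoUpTo W hmod hGZK h124 hX0 h2 hr hss ha hEC hCK ?_
  intro κ γ hκ hγ D
  haveI : Module.Finite (IwasawaAlgebra 2) D.X := Kobayashi2003.SignedSelmerDualData.moduleFinite hγ D
  obtain ⟨DA⟩ := nonempty_signedSelmerDualData A κ (1 : ℤˣ) hγ
  obtain ⟨hfinA, hTorsA, -, hμA⟩ := hA κ γ hκ hγ DA
  haveI := hfinA
  exact hmuT hss ha hAss hAa ⟨e, he⟩ κ γ hκ hγ D DA (hTorsW κ γ hκ hγ D) hTorsA hμA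

/-- **UNIT-ANCHOR TRANSPORT, BSD₂.** The upper half `missingUpperBoundAt_two_of_unitAnchor` together with the class's
Miller LOWER half `MissingLowerBoundAt W 2` (`hsha`: per class a 2-descent / Cassels–Tate certificate, CT2-X5ALL of
record; as a `∀`-statement it is 19097's registered `stub_allMillerLower`) gives `BSDp W 2`
(`missingPPartAt_of_lower_of_upper`, `bsdp_of_missingPPartAt`). [cite: Miller2011LMS, Def. 1.1 and Thm. 1.3]
[cite: BDKim2009, Cor. 2.13] [cite: Kobayashi2003, Thm. 4.1 (p. 8)] [cite: Kato2004Asterisque, Thm. 12.5 (3)] -/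
theorem bsdp_two_of_unitAnchor (hmod : nonempty_modularParametrizationData)
    (hGZK : rank_eq_analyticRank_of_analyticRank_le_one)
    (h124 : Kato2004.thm12_4) (hX0 : Kato2004_fineSelmerDual_isTorsion) (h2 : realPeriodRat_eq_unit_mul_plusPeriod_two)
    (hr : W.analyticRank = 0) (hss : GoodSS W 2) (ha : W.frobeniusTrace 2 = 0)
    (hAr : A.analyticRank = 0) (hAss : GoodSS A 2) (hAa : A.frobeniusTrace 2 = 0)
    (hTam : ¬ 2 ∣ A.tamagawaProduct) (hSha : ¬ 2 ∣ A.shaOrder)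
    (e : WeierstrassCurve.geomTorsion W (2 : ℤ) ≃+ WeierstrassCurve.geomTorsion A (2 : ℤ))
    (he : ∀ (σ : Field.absoluteGaloisGroup ℚ) (P : WeierstrassCurve.geomTorsion W (2 : ℤ)), e (σ • P) = σ • e P)
    (hEC : ∀ (κ : ZpExtension ℚ 2) (γ : Field.absoluteGaloisGroup ℚ),
          κ.IsCyclotomic → κ.IsTopGenerator γ → Finite (W.selmerGroupPInfty 2) →
          Finite (endInvariants (conjSignedSelmerInfty W κ 1 γ - 1)) ∧
            ∃ u : ℤ_[2]ˣ, (Nat.card (endInvariants (conjSignedSelmerInfty W κ 1 γ - 1)) : ℚ_[2]) =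
              ((u : ℤ_[2]) : ℚ_[2]) * ((2 : ℕ) : ℚ_[2]) ^ (padicValNat 2 W.tamagawaProduct) *
                (Nat.card (W.selmerGroupPInfty 2) : ℚ_[2]) *
                  (Nat.card (EndCoinvariants (conjSignedSelmerInfty W κ 1 γ - 1)) : ℚ_[2]))
    (hCK : ∀ (κ : ZpExtension ℚ 2) (γ : Field.absoluteGaloisGroup ℚ),
        κ.IsCyclotomic → κ.IsTopGenerator γ → IsCyclotomicVariable 2 γ →
        ∀ [NeZero (W.conductorNorm ℤ)] (f : CuspForm (Gamma0 (W.conductorNorm ℤ)) 2),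
          IsNewformOf W f → ∀ (ϖ : ℚ), (ϖ : ℝ) * W.realPeriodRat = plusPeriod f →
        ∀ (Lplus Lminus : IwasawaAlgebra 2), IsPollackPair f 2 Lplus Lminus →
        ∀ (D : SignedSelmerDualData W κ γ 1) [ContinuousSMul ℤ_[2] (W.tateModule 2)],
          ∃ (I : Kato2004.IwasawaH1Data W 2 κ γ) (Y : W.FineSelmerDualData κ γ)
            (P : Submodule (IwasawaAlgebra 2) (IwasawaAlgebra 2))
            (loc : I.H →ₗ[IwasawaAlgebra 2] P) (toX : P →ₗ[IwasawaAlgebra 2] D.X)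
            (δ : D.X →ₗ[IwasawaAlgebra 2] Y.X) (Z : Submodule (IwasawaAlgebra 2) I.H)
            (G : IwasawaAlgebra 2),
            Function.Exact loc toX ∧ Function.Exact toX δ ∧
            G ∈ Submodule.map (P.subtype ∘ₗ loc) Z ∧
            iwasawaToPowerSeries 2 G =
              PowerSeries.C (ϖ : ℚ_[2]) * iwasawaToPowerSeries 2 (kobayashiL 1 Lplus Lminus) ∧
            (∀ 𝔭 : PrimeSpectrum (IwasawaAlgebra 2), 𝔭.asIdeal.height = 1 →
              PowerSeries.C (2 : ℤ_[2]) ∉ 𝔭.asIdeal →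
              Literature.NumberTheory.EllipticCurves.Module.lengthAt (IwasawaAlgebra 2) Y.X 𝔭 ≤
                Literature.NumberTheory.EllipticCurves.Module.lengthAt (IwasawaAlgebra 2) (I.H ⧸ Z) 𝔭))
    (hECA : ∀ (κ : ZpExtension ℚ 2) (γ : Field.absoluteGaloisGroup ℚ),
          κ.IsCyclotomic → κ.IsTopGenerator γ → Finite (A.selmerGroupPInfty 2) →
          Finite (endInvariants (conjSignedSelmerInfty A κ 1 γ - 1)) ∧
            ∃ u : ℤ_[2]ˣ, (Nat.card (endInvariants (conjSignedSelmerInfty A κ 1 γ - 1)) : ℚ_[2]) =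
              ((u : ℤ_[2]) : ℚ_[2]) * ((2 : ℕ) : ℚ_[2]) ^ (padicValNat 2 A.tamagawaProduct) *
                (Nat.card (A.selmerGroupPInfty 2) : ℚ_[2]) *
                  (Nat.card (EndCoinvariants (conjSignedSelmerInfty A κ 1 γ - 1)) : ℚ_[2]))
    (hmuT : GoodSS W 2 → W.frobeniusTrace 2 = 0 → GoodSS A 2 → A.frobeniusTrace 2 = 0 →
      (∃ e : WeierstrassCurve.geomTorsion W (2 : ℤ) ≃+ WeierstrassCurve.geomTorsion A (2 : ℤ),
        ∀ (σ : Field.absoluteGaloisGroup ℚ) (P : WeierstrassCurve.geomTorsion W (2 : ℤ)), e (σ • P) = σ • e P) →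
      ∀ (κ : ZpExtension ℚ 2) (γ : Field.absoluteGaloisGroup ℚ), κ.IsCyclotomic → κ.IsTopGenerator γ →
      ∀ (D : SignedSelmerDualData W κ γ 1) (D' : SignedSelmerDualData A κ γ 1)
        [Module.Finite (IwasawaAlgebra 2) D.X] [Module.Finite (IwasawaAlgebra 2) D'.X],
        Module.IsTorsion (IwasawaAlgebra 2) D.X → Module.IsTorsion (IwasawaAlgebra 2) D'.X →
        D'.mu = 0 → D.mu = 0)
    (hsha : MissingLowerBoundAt W 2) : BSDp W 2 :=
  bsdp_of_missingPPartAt W 2 hGZK (hr.le.trans zero_le_one)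
    (missingPPartAt_of_lower_of_upper W 2 hsha
      (missingUpperBoundAt_two_of_unitAnchor W A hmod hGZK h124 hX0 h2 hr hss ha hAr hAss hAa hTam hSha e he hEC hCK
        hECA hmuT))

end Pair

end SSUnitAnchor

end Summit.BirchSwinnertonDyer.BirchSwinnertonDyer.Theorems

end
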